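import Summits.AtomisticToContinuum.Crystallization.Theorems.OverbindingBudgetAffineLayerMain

/-!
# Overbinding budget, affine far-core cell (31280 Z2): HEIGHT DECAY of the dual Bessel sum and ONE ROW FOR ALL FAR LAYERS
# (decomp-a2c lens-4, generation 66, Deliverable G part 1 of 2 = memo NODE-g66 §10 item (T3))

Imports g66 `…LayerMain` (F2: `layerSum_far_encl_of_check`, `abs_layerSum_sub_main_le`; transitively F1, C `…FarSpread`,
B3 `…DualBesselSound` (`DualRow.check_sound`), B2 `…DualBesselKernel` (`dualBesselTerm`, `DualRow`), tree `…LayerPoissonA`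
(`summable_rpow_mul_besselKReal`), tree `…LayerSpread` (`layerShift`), Literature `DualLattice`, `BesselKHalf`).  Restates nothing.
PROVED, 0 sorry, standard axioms (probe `TowerTreeG66G.lean` rc 0 over the TREE imports; pins `TowerTreeG66GPins.lean`;
must-fail `TowerTreeG66GMustFail.lean`).

* §G1 `besselKReal_le_exp_mul` — `K_ν(y) ≤ e^{−(y−x)} K_ν(x)` (`0 < x ≤ y`; from the integral representation and `cosh t ≥ 1`).
* §G2 `dualBesselTerm_le_exp_mul(_of_le)` — the dual Bessel TERM `(πr/d)^μ K_μ(2πdr)` decays in the height: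
  for `d₀ ≤ d`, `r ≥ r₀ ≥ 0`: `term(μ,d,r) ≤ e^{−2π(d−d₀)r₀}·term(μ,d₀,r)`.
* §G3 `one_le_mul_norm_sq_of_mem_dualLattice`, `le_norm_of_mem_dualLattice` — every non-zero dual vector of a planar lattice
  with Gram trace `≤ g₀₀+g₁₁` has `‖w‖ ≥ r₀` whenever `r₀²(g₀₀+g₁₁) ≤ 1`; `summable_dualBesselTerm`; ★ `tsum_dualBesselTerm_le_exp_mul`;
  ★★ `DualRow.check_sound_far` — a certified row at height `dlo ≤ d₀` bounds the dual sum at EVERY height `d ≥ d₀`: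
  `Σ_{w ∈ Λ*} term(μ,d,‖w‖) ≤ e^{−2π(d−d₀)r₀}·R.bound`.
* §G4 `dist_layerShift_eq_abs_mul` — far-layer heights are LINEAR: `dist(layerShift B o k, W_B) = |k|·δ_B`,
  `δ_B = dist(B(√(2/3)e₃), W_B)`; ★★ `layerSum_far_encl_uniform` — for injective `B`, `σ ≥ 2`, `|k| ≥ 4`, every label `o`,
  ONE row `R` (`R.check`, `R.μ+1 = σ`, Gram brackets, `R.dlo ≤ 4δ₁`), enclosures `0 < δ₁ ≤ δ_B ≤ δ₂`, `0 < D₁ ≤ det Gram_B ≤ D₂`,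
  `r₀²(g00hi+g11hi) ≤ 1` and any `Q ≥ e^{−2πδ₁r₀}`:
  `π/((σ−1)√D₂(|k|δ₂)^{2σ−2}) − (2π/(Γσ√Dlo))·bound·Q^{|k|−4} ≤ layerSum B (2σ) k o ≤ π/((σ−1)√D₁(|k|δ₁)^{2σ−2}) + (2π/(Γσ√Dlo))·bound·Q^{|k|−4}`.

Part 2 (`…FarWindow`) sums this over `|k| ≥ 4` and delivers the window sums `T₃↑, T₆↓` as “7 near layers + closed form”.
-/

noncomputable section

open MeasureTheory Set Module
open scoped Real InnerProductSpace

namespace Summit.AtomisticToContinuum.Crystallization.Theorems.OverbindingBudgetAffineFarSmoothSplit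
open Literature.MathematicalPhysics.StatisticalMechanics Literature.Algebra.EuclideanLattices
  Literature.Analysis.FunctionSpaces
local notation "E3" => EuclideanSpace ℝ (Fin 3)

/-! ## §G1 Exponential monotonicity of `K_ν` in the argument -/

section BesselDecay

/-- `K_ν(y) ≤ e^{−(y−x)}·K_ν(x)` for `0 < x ≤ y`: in `K_ν(y) = ∫₀^∞ e^{−y cosh t}cosh(νt)dt` use `cosh t ≥ 1`. [folklore; DLMF 10.32.9] -/
theorem besselKReal_le_exp_mul (ν : ℝ) {x y : ℝ} (hx : 0 < x) (hxy : x ≤ y) :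
    besselKReal ν y ≤ Real.exp (-(y - x)) * besselKReal ν x := by
  unfold besselKReal
  rw [← integral_const_mul]
  refine setIntegral_mono_on (integrableOn_exp_neg_mul_cosh_mul_cosh (hx.trans_le hxy) ν)
    (Integrable.const_mul (integrableOn_exp_neg_mul_cosh_mul_cosh hx ν) _) measurableSet_Ioi fun t _ => ?_
  have hc : 1 ≤ Real.cosh t := Real.one_le_cosh t
  have hcosh : 0 ≤ Real.cosh (ν * t) := (Real.cosh_pos _).le
  rw [← mul_assoc, ← Real.exp_add]
  refine mul_le_mul_of_nonneg_right (Real.exp_le_exp.2 ?_) hcosh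
  nlinarith

/-- The dual Bessel term decays exponentially in the height: `(πr/d)^μ K_μ(2πdr) ≤ e^{−2π(d−d₀)r}·(πr/d₀)^μ K_μ(2πd₀r)` for
`0 < d₀ ≤ d`, `0 < r`. [this file] -/
theorem dualBesselTerm_le_exp_mul (μ : ℕ) {d₀ d r : ℝ} (hd₀ : 0 < d₀) (hd : d₀ ≤ d) (hr : 0 < r) :
    dualBesselTerm μ d r ≤ Real.exp (-(2 * π * (d - d₀) * r)) * dualBesselTerm μ d₀ r := by
  rw [dualBesselTerm_eq_pow, dualBesselTerm_eq_pow]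
  have hd' : 0 < d := lt_of_lt_of_le hd₀ hd
  have h1 : (π * r / d) ^ μ ≤ (π * r / d₀) ^ μ :=
    pow_le_pow_left₀ (by positivity) (div_le_div_of_nonneg_left (by positivity) hd₀ hd) μ
  have h2 : besselKReal μ (2 * π * d * r) ≤ Real.exp (-(2 * π * (d - d₀) * r)) * besselKReal μ (2 * π * d₀ * r) := by
    have h := besselKReal_le_exp_mul (μ : ℝ) (x := 2 * π * d₀ * r) (y := 2 * π * d * r) (by positivity)
      (by nlinarith [Real.pi_pos, mul_pos Real.pi_pos hr])
    have he : -(2 * π * d * r - 2 * π * d₀ * r) = -(2 * π * (d - d₀) * r) := by ring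
    rwa [he] at h
  calc (π * r / d) ^ μ * besselKReal μ (2 * π * d * r)
      ≤ (π * r / d₀) ^ μ * (Real.exp (-(2 * π * (d - d₀) * r)) * besselKReal μ (2 * π * d₀ * r)) :=
        mul_le_mul h1 h2 (besselKReal_pos _ (by positivity)).le (by positivity)
    _ = _ := by ring

/-- Monotone form with a uniform radius: for `r ≥ r₀`, `term(d) ≤ e^{−2π(d−d₀)r₀}·term(d₀)`. [this file] -/
theorem dualBesselTerm_le_exp_mul_of_le (μ : ℕ) {d₀ d r r₀ : ℝ} (hd₀ : 0 < d₀) (hd : d₀ ≤ d) (hr : 0 < r)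
    (hr₀' : r₀ ≤ r) :
    dualBesselTerm μ d r ≤ Real.exp (-(2 * π * (d - d₀) * r₀)) * dualBesselTerm μ d₀ r := by
  refine (dualBesselTerm_le_exp_mul μ hd₀ hd hr).trans (mul_le_mul_of_nonneg_right (Real.exp_le_exp.2 ?_)
    (dualBesselTerm_nonneg μ hd₀ hr))
  have : 0 ≤ 2 * π * (d - d₀) := by have := Real.pi_pos; nlinarith
  nlinarith

end BesselDecay

/-! ## §G2 The shortest nonzero dual vector: `‖w‖²·(‖b₀‖² + ‖b₁‖²) ≥ 1` -/

section DualRadius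

variable {V : Type*} [NormedAddCommGroup V] [InnerProductSpace ℝ V]

/-- A nonzero dual vector of a planar lattice `ℤb₀ + ℤb₁` (spanning the plane) has `(‖b₀‖² + ‖b₁‖²)·‖w‖² ≥ 1`:
its integer coordinates `nᵢ = ⟪w,bᵢ⟫` are not both zero and `n₀² + n₁² ≤ ‖w‖²·tr G` (B2 `inner_sq_add_inner_sq_le`). [this file] -/
theorem one_le_mul_norm_sq_of_mem_dualLattice (b : Fin 2 → V) (hspan : ∀ v : V, v ∈ Submodule.span ℝ (Set.range b))
    (hD : 0 < ‖b 0‖ ^ 2 * ‖b 1‖ ^ 2 - ⟪b 0, b 1⟫_ℝ ^ 2) {w : V}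
    (hw : w ∈ dualLattice (Submodule.span ℤ (Set.range b))) (hw0 : w ≠ 0) :
    1 ≤ (‖b 0‖ ^ 2 + ‖b 1‖ ^ 2) * ‖w‖ ^ 2 := by
  obtain ⟨n0, hn0⟩ := mem_dualLattice.mp hw (b 0) (Submodule.subset_span ⟨0, rfl⟩)
  obtain ⟨n1, hn1⟩ := mem_dualLattice.mp hw (b 1) (Submodule.subset_span ⟨1, rfl⟩)
  have hne : n0 ≠ 0 ∨ n1 ≠ 0 := by
    by_contra h
    rw [not_or, not_ne_iff, not_ne_iff] at h
    obtain ⟨rfl, rfl⟩ := h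
    apply hw0
    have horth : ∀ v ∈ Submodule.span ℝ (Set.range b), ⟪w, v⟫_ℝ = 0 := by
      intro v hv
      refine Submodule.span_induction (p := fun v _ => ⟪w, v⟫_ℝ = 0) ?_ ?_ ?_ ?_ hv
      · rintro _ ⟨i, rfl⟩
        fin_cases i
        · simpa using hn0.symm
        · simpa using hn1.symm
      · exact inner_zero_right _
      · intro x y _ _ hx hy; rw [inner_add_right, hx, hy, add_zero]
      · intro a x _ hx; rw [inner_smul_right, hx, mul_zero]
    have h := horth w (hspan w)
    rwa [real_inner_self_eq_norm_sq, sq_eq_zero_iff, norm_eq_zero] at h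
  have hsq : (1 : ℝ) ≤ ⟪w, b 0⟫_ℝ ^ 2 + ⟪w, b 1⟫_ℝ ^ 2 := by
    rw [← hn0, ← hn1]
    have h : (1 : ℤ) ≤ n0 ^ 2 + n1 ^ 2 := by
      rcases hne with h | h
      · nlinarith [Int.one_le_abs h, sq_abs n0, sq_nonneg n1]
      · nlinarith [Int.one_le_abs h, sq_abs n1, sq_nonneg n0]
    exact_mod_cast h
  have hcs := inner_sq_add_inner_sq_le b (hspan w) hD
  linarith

/-- Rational form: if `r₀² · (g₀₀ʰⁱ + g₁₁ʰⁱ) ≤ 1` with `‖bᵢ‖² ≤ gᵢᵢʰⁱ`, `0 ≤ r₀`, then every nonzero dual vector has `r₀ ≤ ‖w‖`. [this file] -/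
theorem le_norm_of_mem_dualLattice (b : Fin 2 → V) (hspan : ∀ v : V, v ∈ Submodule.span ℝ (Set.range b))
    (hD : 0 < ‖b 0‖ ^ 2 * ‖b 1‖ ^ 2 - ⟪b 0, b 1⟫_ℝ ^ 2) {g00 g11 r₀ : ℝ} (h00 : ‖b 0‖ ^ 2 ≤ g00) (h11 : ‖b 1‖ ^ 2 ≤ g11)
    (hr₀ : 0 ≤ r₀) (hr : r₀ ^ 2 * (g00 + g11) ≤ 1) {w : V}
    (hw : w ∈ dualLattice (Submodule.span ℤ (Set.range b))) (hw0 : w ≠ 0) : r₀ ≤ ‖w‖ := by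
  have h1 := one_le_mul_norm_sq_of_mem_dualLattice b hspan hD hw hw0
  have htr : 0 < ‖b 0‖ ^ 2 + ‖b 1‖ ^ 2 := by
    rcases (mul_pos_iff.mp (lt_of_lt_of_le zero_lt_one h1)) with ⟨h, -⟩ | ⟨h, h'⟩
    · exact h
    · exact absurd h' (not_lt.mpr (sq_nonneg _))
  have h2 : r₀ ^ 2 ≤ ‖w‖ ^ 2 := by
    have : r₀ ^ 2 * (‖b 0‖ ^ 2 + ‖b 1‖ ^ 2) ≤ 1 := le_trans (by nlinarith) hr
    by_contra hlt
    rw [not_le] at hlt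
    nlinarith
  exact (pow_le_pow_iff_left₀ hr₀ (norm_nonneg _) two_ne_zero).mp h2

end DualRadius

/-! ## §G3 Exponential decay of the dual Bessel SUM in the height, and the far-row corollary of the kernel -/

section DualSum

variable {V : Type*} [NormedAddCommGroup V] [InnerProductSpace ℝ V] [FiniteDimensional ℝ V]

/-- The dual Bessel family is summable over any lattice (`μ ≥ 1`, `d > 0`) — the landed `summable_rpow_mul_besselKReal`
at `c = d²`. [this file] -/
theorem summable_dualBesselTerm (Λ : Submodule ℤ V) [DiscreteTopology Λ] [IsZLattice ℝ Λ] {μ : ℕ} (hμ : μ ≠ 0)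
    {d : ℝ} (hd : 0 < d) : Summable fun w : Λ => dualBesselTerm μ d ‖(w : V)‖ := by
  have h := summable_rpow_mul_besselKReal Λ (μ := (μ : ℝ)) (c := d ^ 2) (by exact_mod_cast Nat.pos_of_ne_zero hμ)
    (by positivity)
  rw [Real.sqrt_sq hd.le] at h
  exact h

/-- ★ **Height decay of the dual Bessel sum**: if every nonzero dual vector has `‖w‖ ≥ r₀`, then for `0 < d₀ ≤ d`
`Σ_{w∈Λ*} (π‖w‖/d)^μ K_μ(2πd‖w‖) ≤ e^{−2π(d−d₀)r₀} · Σ_{w∈Λ*} (π‖w‖/d₀)^μ K_μ(2πd₀‖w‖)`. [this file] -/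
theorem tsum_dualBesselTerm_le_exp_mul (b : Module.Basis (Fin 2) ℝ V) {μ : ℕ} (hμ : μ ≠ 0) {d₀ d r₀ : ℝ}
    (hd₀ : 0 < d₀) (hd : d₀ ≤ d)
    (hrad : ∀ w : V, w ∈ dualLattice (Submodule.span ℤ (Set.range ⇑b)) → w ≠ 0 → r₀ ≤ ‖w‖) :
    ∑' w : dualLattice (Submodule.span ℤ (Set.range ⇑b)), dualBesselTerm μ d ‖(w : V)‖ ≤
      Real.exp (-(2 * π * (d - d₀) * r₀)) *
        ∑' w : dualLattice (Submodule.span ℤ (Set.range ⇑b)), dualBesselTerm μ d₀ ‖(w : V)‖ := by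
  rw [← tsum_mul_left]
  refine Summable.tsum_le_tsum (fun w => ?_) (summable_dualBesselTerm _ hμ (hd₀.trans_le hd))
    ((summable_dualBesselTerm _ hμ hd₀).mul_left _)
  by_cases hw0 : (w : V) = 0
  · rw [hw0, norm_zero, dualBesselTerm_zero hμ, dualBesselTerm_zero hμ, mul_zero]
  · exact dualBesselTerm_le_exp_mul_of_le μ hd₀ hd (norm_pos_iff.2 hw0) (hrad w w.2 hw0)

/-- ★★ **Far-row corollary of the kernel**: ONE certified row `R` (`R.check = true`) bounds the dual Bessel sum at EVERY height
`d ≥ d₀ ≥ R.dlo` with the extra decay factor `e^{−2π(d−d₀)r₀}`, for any rational radius `r₀ ≥ 0` with `r₀²(g₀₀ʰⁱ + g₁₁ʰⁱ) ≤ 1`: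
`Σ_{w∈Λ*} (π‖w‖/d)^μ K_μ(2πd‖w‖) ≤ e^{−2π(d−d₀)r₀} · R.bound`. [this file] -/
theorem DualRow.check_sound_far (R : DualRow) (hR : R.check = true) (b : Module.Basis (Fin 2) ℝ V)
    (h00 : (R.g00lo : ℝ) ≤ ‖b 0‖ ^ 2 ∧ ‖b 0‖ ^ 2 ≤ R.g00hi) (h01 : (R.g01lo : ℝ) ≤ ⟪b 0, b 1⟫_ℝ ∧ ⟪b 0, b 1⟫_ℝ ≤ R.g01hi)
    (h11 : (R.g11lo : ℝ) ≤ ‖b 1‖ ^ 2 ∧ ‖b 1‖ ^ 2 ≤ R.g11hi) {d₀ d : ℝ} (hd₀ : (R.dlo : ℝ) ≤ d₀) (hd : d₀ ≤ d)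
    {r₀ : ℚ} (hr₀ : 0 ≤ r₀) (hr : r₀ ^ 2 * (R.g00hi + R.g11hi) ≤ 1) :
    ∑' w : dualLattice (Submodule.span ℤ (Set.range ⇑b)), dualBesselTerm R.μ d ‖(w : V)‖ ≤
      Real.exp (-(2 * π * (d - d₀) * r₀)) * R.bound := by
  have hR' := hR
  simp only [DualRow.check, Bool.and_eq_true, decide_eq_true_eq, List.all_eq_true, Bool.or_eq_true] at hR'
  obtain ⟨⟨⟨⟨⟨⟨⟨⟨⟨⟨⟨⟨⟨⟨⟨⟨⟨⟨hμ1, hdlo⟩, hg00⟩, hg11⟩, -⟩, -⟩, -⟩, hDlo⟩, -⟩, -⟩, -⟩, -⟩, -⟩, -⟩, -⟩, -⟩, -⟩,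
    -⟩, -⟩ := hR'
  have hμ0 : R.μ ≠ 0 := by omega
  have hdlo' : (0 : ℝ) < R.dlo := by exact_mod_cast hdlo
  have hd₀' : 0 < d₀ := lt_of_lt_of_le hdlo' hd₀
  have hDR : ((R.Dlo : ℚ) : ℝ) ≤ ‖b 0‖ ^ 2 * ‖b 1‖ ^ 2 - ⟪b 0, b 1⟫_ℝ ^ 2 := R.Dlo_le hg00.le hg11.le h00.1 h01 h11.1
  have hDlo' : (0 : ℝ) < R.Dlo := by exact_mod_cast hDlo
  have hD : 0 < ‖b 0‖ ^ 2 * ‖b 1‖ ^ 2 - ⟪b 0, b 1⟫_ℝ ^ 2 := lt_of_lt_of_le hDlo' hDR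
  have hr₀' : (0 : ℝ) ≤ r₀ := by exact_mod_cast hr₀
  have hr' : (r₀ : ℝ) ^ 2 * ((R.g00hi : ℝ) + R.g11hi) ≤ 1 := by exact_mod_cast hr
  have hrad : ∀ w : V, w ∈ dualLattice (Submodule.span ℤ (Set.range ⇑b)) → w ≠ 0 → (r₀ : ℝ) ≤ ‖w‖ := fun w hw hw0 =>
    le_norm_of_mem_dualLattice (⇑b) (fun v => b.mem_span v) hD h00.2 h11.2 hr₀' hr' hw hw0
  have h1 := tsum_dualBesselTerm_le_exp_mul b hμ0 hd₀' hd hrad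
  have h2 := R.check_sound hR (⇑b) (fun v => b.mem_span v) h00 h01 h11 hd₀
  exact h1.trans (mul_le_mul_of_nonneg_left h2 (Real.exp_pos _).le)

end DualSum

/-! ## §G4 Window vocabulary: far-layer heights are linear in `|k|`; ONE kernel row encloses ALL far layers -/

/-- The height of layer `k` above the plane `W_B = span{Bt₁, Bt₂}` is LINEAR in `|k|`:
`dist(layerShift B o k, W_B) = |k|·δ_B`, `δ_B = dist(B(√(2/3)e₃), W_B)` — the in-plane part `o·B(barlowOffset 1) ∈ W_B` drops out
and the orthogonal projection is linear. [this file] -/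
theorem dist_layerShift_eq_abs_mul (B : E3 →ₗ[ℝ] E3) (o k : ℤ) :
    ‖layerShift B o k - (Submodule.span ℝ (Set.range ![B (triangularVec₁ 1), B (triangularVec₂ 1)])).starProjection
        (layerShift B o k)‖ =
      |(k : ℝ)| * ‖B (layerNormal (Real.sqrt (2 / 3))) - (Submodule.span ℝ
        (Set.range ![B (triangularVec₁ 1), B (triangularVec₂ 1)])).starProjection (B (layerNormal (Real.sqrt (2 / 3))))‖ := by
  have hv : (o : ℝ) • B (barlowOffset (1 : ℝ)) ∈
      Submodule.span ℝ (Set.range ![B (triangularVec₁ 1), B (triangularVec₂ 1)]) := by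
    rw [barlowOffset_one_eq, map_smul, map_add]
    refine Submodule.smul_mem _ _ (Submodule.smul_mem _ _ (Submodule.add_mem _ ?_ ?_))
    · exact Submodule.subset_span ⟨0, rfl⟩
    · exact Submodule.subset_span ⟨1, rfl⟩
  have hP : (Submodule.span ℝ (Set.range ![B (triangularVec₁ 1), B (triangularVec₂ 1)])).starProjection
      ((o : ℝ) • B (barlowOffset (1 : ℝ))) = (o : ℝ) • B (barlowOffset (1 : ℝ)) :=
    Submodule.starProjection_eq_self_iff.mpr hv
  rw [layerShift, map_add, hP, add_sub_add_left_eq_sub, map_smul, ← smul_sub, norm_smul, Real.norm_eq_abs]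

/-- ★★ **Uniform far-layer enclosure from ONE row.**  Let `B` be injective, `σ ≥ 2`, `|k| ≥ 4`, and let `R` be a certified dual
Bessel row (`R.check = true`, `R.μ + 1 = σ`) whose Gram enclosures contain `Gram(Bt₁, Bt₂)` and whose `dlo ≤ 4δ₁`, where
`0 < δ₁ ≤ δ_B ≤ δ₂` bracket the unit layer height `δ_B = dist(B(√(2/3)e₃), W_B)` and `0 < D₁ ≤ det Gram ≤ D₂`; let `r₀ ≥ 0` be
rational with `r₀²(g₀₀ʰⁱ + g₁₁ʰⁱ) ≤ 1` and `e^{−2πδ₁r₀} ≤ Q`.  Then for EVERY label `o`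
`π/((σ−1)√D₂(|k|δ₂)^{2σ−2}) − (2π/(Γσ√(R.Dlo)))·R.bound·Q^{|k|−4} ≤ layerSum B (2σ) k o ≤ π/((σ−1)√D₁(|k|δ₁)^{2σ−2}) + (2π/(Γσ√(R.Dlo)))·R.bound·Q^{|k|−4}`:
the far layers of both window sums are enclosed, all at once, by rational data with a GEOMETRICALLY decaying remainder. [this file] -/
theorem layerSum_far_encl_uniform (B : E3 →ₗ[ℝ] E3) (hB : Function.Injective B)
    [MeasurableSpace (Submodule.span ℝ (Set.range ![B (triangularVec₁ 1), B (triangularVec₂ 1)]))]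
    [BorelSpace (Submodule.span ℝ (Set.range ![B (triangularVec₁ 1), B (triangularVec₂ 1)]))]
    (σ : ℕ) (hσ : 1 < σ) {k : ℤ} (hk : 4 ≤ |k|) (o : ℤ) (R : DualRow) (hR : R.check = true) (hμ : R.μ + 1 = σ)
    (h00 : (R.g00lo : ℝ) ≤ ‖B (triangularVec₁ 1)‖ ^ 2 ∧ ‖B (triangularVec₁ 1)‖ ^ 2 ≤ R.g00hi)
    (h01 : (R.g01lo : ℝ) ≤ ⟪B (triangularVec₁ 1), B (triangularVec₂ 1)⟫_ℝ ∧ ⟪B (triangularVec₁ 1), B (triangularVec₂ 1)⟫_ℝ ≤ R.g01hi)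
    (h11 : (R.g11lo : ℝ) ≤ ‖B (triangularVec₂ 1)‖ ^ 2 ∧ ‖B (triangularVec₂ 1)‖ ^ 2 ≤ R.g11hi)
    {δ₁ δ₂ D₁ D₂ : ℝ} (hδ₁ : 0 < δ₁)
    (hδ₁' : δ₁ ≤ ‖B (layerNormal (Real.sqrt (2 / 3))) - (Submodule.span ℝ
        (Set.range ![B (triangularVec₁ 1), B (triangularVec₂ 1)])).starProjection (B (layerNormal (Real.sqrt (2 / 3))))‖)
    (hδ₂ : ‖B (layerNormal (Real.sqrt (2 / 3))) - (Submodule.span ℝ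
        (Set.range ![B (triangularVec₁ 1), B (triangularVec₂ 1)])).starProjection (B (layerNormal (Real.sqrt (2 / 3))))‖ ≤ δ₂)
    (hdlo : (R.dlo : ℝ) ≤ 4 * δ₁) (hD₁ : 0 < D₁)
    (hD₁' : D₁ ≤ ‖B (triangularVec₁ 1)‖ ^ 2 * ‖B (triangularVec₂ 1)‖ ^ 2 - ⟪B (triangularVec₁ 1), B (triangularVec₂ 1)⟫_ℝ ^ 2)
    (hD₂ : ‖B (triangularVec₁ 1)‖ ^ 2 * ‖B (triangularVec₂ 1)‖ ^ 2 - ⟪B (triangularVec₁ 1), B (triangularVec₂ 1)⟫_ℝ ^ 2 ≤ D₂)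
    {r₀ : ℚ} (hr₀ : 0 ≤ r₀) (hr : r₀ ^ 2 * (R.g00hi + R.g11hi) ≤ 1) {Q : ℝ} (hQ : Real.exp (-(2 * π * δ₁ * r₀)) ≤ Q) :
    π / (((σ : ℝ) - 1) * Real.sqrt D₂ * (|(k : ℝ)| * δ₂) ^ (2 * σ - 2)) -
          2 * π / (Real.Gamma σ * Real.sqrt R.Dlo) * R.bound * Q ^ (k.natAbs - 4) ≤ layerSum B (2 * σ) k o ∧
      layerSum B (2 * σ) k o ≤
        π / (((σ : ℝ) - 1) * Real.sqrt D₁ * (|(k : ℝ)| * δ₁) ^ (2 * σ - 2)) +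
          2 * π / (Real.Gamma σ * Real.sqrt R.Dlo) * R.bound * Q ^ (k.natAbs - 4) := by
  -- certificate facts
  have hR' := hR
  simp only [DualRow.check, Bool.and_eq_true, decide_eq_true_eq, List.all_eq_true, Bool.or_eq_true] at hR'
  obtain ⟨⟨⟨⟨⟨⟨⟨⟨⟨⟨⟨⟨⟨⟨⟨⟨⟨⟨hμ1, hdlo0⟩, hg00⟩, hg11⟩, -⟩, -⟩, -⟩, hDlo⟩, -⟩, -⟩, -⟩, -⟩, -⟩, -⟩, -⟩, -⟩, -⟩,
    -⟩, hbd⟩ := hR'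
  have hk0 : k ≠ 0 := by rintro rfl; simp at hk
  set b : Module.Basis (Fin 2) ℝ (Submodule.span ℝ (Set.range ![B (triangularVec₁ 1), B (triangularVec₂ 1)])) :=
    Module.Basis.span (linearIndependent_map_pair B hB) with hbdef
  have hdist := dist_layerShift_eq_abs_mul B o k
  generalize hδ : ‖B (layerNormal (Real.sqrt (2 / 3))) - (Submodule.span ℝ
        (Set.range ![B (triangularVec₁ 1), B (triangularVec₂ 1)])).starProjection (B (layerNormal (Real.sqrt (2 / 3))))‖ = δ
    at hδ₁' hδ₂ hdist
  have hb0 : ((b 0 : Submodule.span ℝ (Set.range ![B (triangularVec₁ 1), B (triangularVec₂ 1)])) : E3) =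
      B (triangularVec₁ 1) := by rw [hbdef, Module.Basis.span_apply]; rfl
  have hb1 : ((b 1 : Submodule.span ℝ (Set.range ![B (triangularVec₁ 1), B (triangularVec₂ 1)])) : E3) =
      B (triangularVec₂ 1) := by rw [hbdef, Module.Basis.span_apply]; rfl
  have hn0 : ‖b 0‖ = ‖B (triangularVec₁ 1)‖ := by rw [Submodule.coe_norm, hb0]
  have hn1 : ‖b 1‖ = ‖B (triangularVec₂ 1)‖ := by rw [Submodule.coe_norm, hb1]
  have hi01 : ⟪b 0, b 1⟫_ℝ = ⟪B (triangularVec₁ 1), B (triangularVec₂ 1)⟫_ℝ := by rw [Submodule.coe_inner, hb0, hb1]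
  have hk4 : (4 : ℝ) ≤ |(k : ℝ)| := by rw [← Int.cast_abs]; exact_mod_cast hk
  have hδ0 : 0 < δ := lt_of_lt_of_le hδ₁ hδ₁'
  have hdlo' : (0 : ℝ) < R.dlo := by exact_mod_cast hdlo0
  have hd₀ : (R.dlo : ℝ) ≤ 4 * δ := hdlo.trans (by nlinarith)
  have hd₀dd : 4 * δ ≤ |(k : ℝ)| * δ := mul_le_mul_of_nonneg_right hk4 hδ0.le
  have hdd0 : 0 < |(k : ℝ)| * δ := lt_of_lt_of_le (by positivity) hd₀dd
  have hμ0 : R.μ ≠ 0 := by omega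
  -- the certified, DECAYED dual sum
  have hsum : ∑' w : dualLattice (Submodule.span ℤ (Set.range ⇑b)),
      dualBesselTerm R.μ (|(k : ℝ)| * δ) ‖(w : Submodule.span ℝ (Set.range ![B (triangularVec₁ 1), B (triangularVec₂ 1)]))‖ ≤
        Real.exp (-(2 * π * (|(k : ℝ)| * δ - 4 * δ) * r₀)) * R.bound :=
    R.check_sound_far hR b (by rw [hn0]; exact h00) (by rw [hi01]; exact h01) (by rw [hn1]; exact h11) hd₀ hd₀dd hr₀ hr
  have hsum0 := tsum_dualBesselTerm_nonneg (Submodule.span ℤ (Set.range ⇑b)) hμ0 hdd0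
  -- the decay factor `e^{−2π(|k|δ − 4δ)r₀} ≤ Q^{|k|−4}`
  have hr₀' : (0 : ℝ) ≤ r₀ := by exact_mod_cast hr₀
  have hnat : ((k.natAbs - 4 : ℕ) : ℝ) = |(k : ℝ)| - 4 := by
    have h4 : 4 ≤ k.natAbs := by
      have h := hk; rw [Int.abs_eq_natAbs] at h; exact_mod_cast h
    rw [Nat.cast_sub h4, Nat.cast_natAbs, Int.cast_abs]; norm_num
  have hexp : Real.exp (-(2 * π * (|(k : ℝ)| * δ - 4 * δ) * r₀)) ≤ Q ^ (k.natAbs - 4) := by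
    have h1 : Real.exp (-(2 * π * (|(k : ℝ)| * δ - 4 * δ) * r₀)) ≤ Real.exp (-(2 * π * δ₁ * r₀)) ^ (k.natAbs - 4) := by
      rw [← Real.exp_nat_mul, hnat]
      refine Real.exp_le_exp.2 ?_
      have : (|(k : ℝ)| - 4) * δ₁ ≤ (|(k : ℝ)| - 4) * δ := mul_le_mul_of_nonneg_left hδ₁' (by linarith)
      have hπ := Real.pi_pos
      nlinarith [mul_nonneg (mul_nonneg hπ.le hr₀') (sub_nonneg.2 this)]
    exact h1.trans (pow_le_pow_left₀ (Real.exp_pos _).le hQ _)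
  -- the covolume
  have hcovdet : ZLattice.covolume (Submodule.span ℤ (Set.range ⇑b)) =
      Real.sqrt (‖B (triangularVec₁ 1)‖ ^ 2 * ‖B (triangularVec₂ 1)‖ ^ 2 - ⟪B (triangularVec₁ 1), B (triangularVec₂ 1)⟫_ℝ ^ 2) := by
    rw [covolume_span_eq_sqrt_gramDet b, hn0, hn1, hi01]
  have hDR : ((R.Dlo : ℚ) : ℝ) ≤ ‖B (triangularVec₁ 1)‖ ^ 2 * ‖B (triangularVec₂ 1)‖ ^ 2 -
      ⟪B (triangularVec₁ 1), B (triangularVec₂ 1)⟫_ℝ ^ 2 := R.Dlo_le hg00.le hg11.le h00.1 h01 h11.1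
  have hDlo' : (0 : ℝ) < R.Dlo := by exact_mod_cast hDlo
  have hcovR : Real.sqrt R.Dlo ≤ ZLattice.covolume (Submodule.span ℤ (Set.range ⇑b)) := by
    rw [hcovdet]; exact Real.sqrt_le_sqrt hDR
  have hcov1 : Real.sqrt D₁ ≤ ZLattice.covolume (Submodule.span ℤ (Set.range ⇑b)) := by
    rw [hcovdet]; exact Real.sqrt_le_sqrt hD₁'
  have hcov2 : ZLattice.covolume (Submodule.span ℤ (Set.range ⇑b)) ≤ Real.sqrt D₂ := by
    rw [hcovdet]; exact Real.sqrt_le_sqrt hD₂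
  have hsq0 : 0 < Real.sqrt R.Dlo := Real.sqrt_pos.2 hDlo'
  have hsq1 : 0 < Real.sqrt D₁ := Real.sqrt_pos.2 hD₁
  have hcov0 : 0 < ZLattice.covolume (Submodule.span ℤ (Set.range ⇑b)) := lt_of_lt_of_le hsq1 hcov1
  have hΓ : 0 < Real.Gamma σ := Real.Gamma_pos_of_pos (by exact_mod_cast (by omega : 0 < σ))
  have hs1 : (0 : ℝ) < (σ : ℝ) - 1 := by
    have : (1 : ℝ) < σ := by exact_mod_cast hσ
    linarith
  have hbd0 : (0 : ℝ) ≤ R.bound := (mul_nonneg_iff_of_pos_left (Real.exp_pos _)).mp (hsum0.trans hsum)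
  -- the main inequality and its two relaxations
  have hmain := abs_layerSum_sub_main_le B hB σ hσ hk0 o
  rw [spread_tsum_eq_tsum_dualBesselTerm _ hμ, hdist] at hmain
  rw [abs_sub_le_iff] at hmain
  obtain ⟨hup, hlow⟩ := hmain
  have hrem : 2 * π / (Real.Gamma σ * ZLattice.covolume (Submodule.span ℤ (Set.range ⇑b))) *
      (∑' w : dualLattice (Submodule.span ℤ (Set.range ⇑b)),
        dualBesselTerm R.μ (|(k : ℝ)| * δ) ‖(w : Submodule.span ℝ (Set.range ![B (triangularVec₁ 1), B (triangularVec₂ 1)]))‖) ≤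
      2 * π / (Real.Gamma σ * Real.sqrt R.Dlo) * R.bound * Q ^ (k.natAbs - 4) := by
    have hA : 2 * π / (Real.Gamma σ * ZLattice.covolume (Submodule.span ℤ (Set.range ⇑b))) ≤
        2 * π / (Real.Gamma σ * Real.sqrt R.Dlo) :=
      div_le_div_of_nonneg_left (by positivity) (mul_pos hΓ hsq0) (mul_le_mul_of_nonneg_left hcovR hΓ.le)
    have hB' : (∑' w : dualLattice (Submodule.span ℤ (Set.range ⇑b)),
        dualBesselTerm R.μ (|(k : ℝ)| * δ) ‖(w : Submodule.span ℝ (Set.range ![B (triangularVec₁ 1), B (triangularVec₂ 1)]))‖) ≤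
        R.bound * Q ^ (k.natAbs - 4) := by
      calc _ ≤ Real.exp (-(2 * π * (|(k : ℝ)| * δ - 4 * δ) * r₀)) * R.bound := hsum
        _ ≤ Q ^ (k.natAbs - 4) * R.bound := mul_le_mul_of_nonneg_right hexp hbd0
        _ = R.bound * Q ^ (k.natAbs - 4) := mul_comm _ _
    calc _ ≤ 2 * π / (Real.Gamma σ * Real.sqrt R.Dlo) * (R.bound * Q ^ (k.natAbs - 4)) :=
          mul_le_mul hA hB' hsum0 (by positivity)
      _ = _ := by ring
  have hm_up : π / (((σ : ℝ) - 1) * ZLattice.covolume (Submodule.span ℤ (Set.range ⇑b)) * (|(k : ℝ)| * δ) ^ (2 * σ - 2)) ≤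
      π / (((σ : ℝ) - 1) * Real.sqrt D₁ * (|(k : ℝ)| * δ₁) ^ (2 * σ - 2)) := by
    refine div_le_div_of_nonneg_left Real.pi_pos.le (by positivity) ?_
    have h1 : (|(k : ℝ)| * δ₁) ^ (2 * σ - 2) ≤ (|(k : ℝ)| * δ) ^ (2 * σ - 2) :=
      pow_le_pow_left₀ (by positivity) (mul_le_mul_of_nonneg_left hδ₁' (abs_nonneg _)) _
    have h2 : ((σ : ℝ) - 1) * Real.sqrt D₁ ≤ ((σ : ℝ) - 1) * ZLattice.covolume (Submodule.span ℤ (Set.range ⇑b)) :=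
      mul_le_mul_of_nonneg_left hcov1 hs1.le
    exact mul_le_mul h2 h1 (by positivity) (by positivity)
  have hm_low : π / (((σ : ℝ) - 1) * Real.sqrt D₂ * (|(k : ℝ)| * δ₂) ^ (2 * σ - 2)) ≤
      π / (((σ : ℝ) - 1) * ZLattice.covolume (Submodule.span ℤ (Set.range ⇑b)) * (|(k : ℝ)| * δ) ^ (2 * σ - 2)) := by
    refine div_le_div_of_nonneg_left Real.pi_pos.le (by positivity) ?_
    have h1 : (|(k : ℝ)| * δ) ^ (2 * σ - 2) ≤ (|(k : ℝ)| * δ₂) ^ (2 * σ - 2) :=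
      pow_le_pow_left₀ hdd0.le (mul_le_mul_of_nonneg_left hδ₂ (abs_nonneg _)) _
    have h2 : ((σ : ℝ) - 1) * ZLattice.covolume (Submodule.span ℤ (Set.range ⇑b)) ≤ ((σ : ℝ) - 1) * Real.sqrt D₂ :=
      mul_le_mul_of_nonneg_left hcov2 hs1.le
    exact mul_le_mul h2 h1 (by positivity) (le_trans (by positivity) h2)
  constructor <;> linarith

end Summit.AtomisticToContinuum.Crystallization.Theorems.OverbindingBudgetAffineFarSmoothSplit

end
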